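import Literature.NumberTheory.Automorphic.ArchIsotypicTransfer
import Literature.NumberTheory.Automorphic.CuspidalRepFiniteComponent
import Literature.NumberTheory.Automorphic.TestFunctionGLLeftInvariance
import HarnessLib

/-!
# Uniqueness of global Whittaker functionals from local uniqueness: the reduction

For a cuspidal automorphic representation `Π ≤ L²_cusp(GL_n(K)\GL_n(𝔸_K))` with archimedean
component `τ` (on `E`; `CuspidalRepArchIsotypic`), this file carries out the *algebraic* part of
the printed deduction of the uniqueness of global `ψ`-Whittaker functionals on `Π` from local
uniqueness (Cogdell (2004), §1.2, proof of Cor. 1.4: "`Λ = ⊗_v Λ_v` … by the local uniqueness";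
Bump (1997), Thm. 3.5.2 and its proof; Getz–Hahn (2024), proof of Thm. 11.3.4):

* the smooth multiplicity module `M = multiplicityModule hcpt τ Π = ⋃_{U₀} Hom_{G_∞}(τ, Π^{U₀})`
  of `CuspidalRepFiniteComponent` (a smooth `GL_n(𝔸_K^∞)`-module under `(y · T) = R((1, y)) ∘ T`,
  playing the role of `π_f` in `Π ≅ π_∞ ⊗ π_f`);
* `finWhittakerFunctionals hcpt τ Π` — the `ψ_f`-Whittaker functionals on `M`
  (`Λ(u · T) = ψ_f(u) Λ(T)`, `u ∈ N_n(𝔸_K^∞)`, for the action `finComponentRep`).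
* `transferMap ℓ hτ : M →ₗ (archGardingSpace τ →ₗ ℂ)`, `T ↦ ℓ ∘ T̂` — for a continuous global
  `ψ`-Whittaker functional `ℓ` its values are continuous `ψ_∞`-Whittaker functionals on `τ`
  (`transferMap_mem_archContWhittakerFunctionals`) and it is `ψ_f`-equivariant in `T`
  (`transferMap_finComponentRep_unipotent`).
* `exists_eq_smul_of_local_uniqueness` — **the reduction**: if the continuous `ψ_∞`-Whittaker
  functionals on `τ` are unique up to scalars (Shalika's archimedean local multiplicity one,
  Getz–Hahn Thm. 11.3.1 for `F` archimedean) and the `ψ_f`-Whittaker functionals on `M` are unique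
  up to scalars (the non-archimedean local multiplicity one assembled over the finite places), then
  the continuous `ψ`-Whittaker functionals on the Gårding space of `Π` are unique up to scalars —
  via `ℓ(v) = Σ_i Λ_ℓ(S_i) lam₀(S_i† v)` on `gardingSubspace Π U₀` (`apply_eq_sum_transferMap`).

All statements are theorems (no named fact); the two local uniqueness statements enter as
hypotheses of the reduction.

## References

* J. W. Cogdell, *Lectures on L-functions, converse theorems, and functoriality for GL_n*, Fields
  Inst. Monogr. 20 (2004), §1.2.
* D. Bump, *Automorphic forms and representations* (1997), Thm. 3.5.2.
* J. R. Getz, H. Hahn, *An introduction to automorphic representations* (2024), §11.3.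
* J. A. Shalika, *The multiplicity one theorem for GL_n*, Ann. of Math. 100 (1974), Thm. 3.1, §5.
-/

noncomputable section

open MeasureTheory Measure NumberField NumberField.mixedEmbedding IsDedekindDomain Set Filter
open scoped MatrixGroups InnerProductSpace Topology Classical NNReal ContDiff Matrix.Norms.Operator

namespace Literature.NumberTheory.Automorphic

variable {n : ℕ} {K : Type} [Field K] [NumberField K]
  {μ : Measure (AdelicGroupData.gl n K).automorphicQuotient}
  [(AdelicGroupData.gl n K).IsAutomorphicMeasure μ]

attribute [local instance] adelicBorel borelSpace_adelic locallyCompactSpace_adelic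
  secondCountableTopology_gl_adelic glInfBorel borelSpace_glInf locallyCompactSpace_glInf
  secondCountableTopology_glInf

set_option synthInstance.maxHeartbeats 200000

-- Mathlib idiom (Mathlib/Algebra/Lie/OfAssociative.lean): the commutator Lie ring on matrices
attribute [local instance 100] LieRing.ofAssociativeRing

-- as in `ArchGardingWhittaker`: the scoped `L∞`-operator normed ring structure on matrices (through
-- which `IsArchSmooth` is defined) is only reducibly defeq to the Pi uniformity
set_option backward.isDefEq.respectTransparency false

/-! ### 1. `ψ_f`-Whittaker functionals on the multiplicity module -/

section FinWhittaker

variable (n K)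

/-- `(1, u) ∈ N_n(𝔸_K)` for `u ∈ N_n(𝔸_K^∞)` (entries of `(1, u)`; the tree's
`ofFinite_mem_adelicUnipotent` of `IwasawaCoordinatesAdelic`, re-proved privately to keep imports
light). [folklore] -/
private theorem ofFinite_mem_adelicUnipotent' {u : GL (Fin n) (FiniteAdeleRing (𝓞 K) K)}
    (hu : u ∈ upperUnitriangular (Fin n) (FiniteAdeleRing (𝓞 K) K)) :
    GLn.ofFinite n K u ∈ adelicUnipotent n K := by
  rw [mem_upperUnitriangular_iff] at hu ⊢
  refine ⟨fun i j hij => ?_, fun i => ?_⟩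
  · rw [GLn.coe_ofFinite_apply, hu.1 hij]
    exact Prod.ext (Matrix.one_apply_ne (ne_of_gt hij)) rfl
  · rw [GLn.coe_ofFinite_apply, hu.2 i]
    exact Prod.ext (Matrix.one_apply_eq i) rfl

/-- **The finite-adelic generic character `ψ_f` of `N_n(𝔸_K^∞)`**: the restriction along
`u ↦ (1, u)` of the standard generic character `ψ_N` of `N_n(𝔸_K)` attached to Tate's `ψ_K`
(`whittakerCharFun (adeleAddChar K)`), `ψ_f(u) = ψ_{K,f}(u_{12} + ⋯ + u_{n-1,n})`; so that
`ψ_N((u_∞, u_f)) = ψ_∞(u_∞) ψ_f(u_f)` (Cogdell (2004), §1.1). [cite: CogdellAnalyticTheory2004, §1.1] -/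
def finWhittakerChar (u : ↥(upperUnitriangular (Fin n) (FiniteAdeleRing (𝓞 K) K))) : ℂ :=
  whittakerCharFun (adeleAddChar K) ⟨GLn.ofFinite n K u, ofFinite_mem_adelicUnipotent' n K u.2⟩

variable {n K}
variable {hcpt : isCompact_glFiniteIntegralLevel n K}
  {E : Type*} [NormedAddCommGroup E] [InnerProductSpace ℂ E] [CompleteSpace E]
  {τ : ContRepresentation ℂ (AutomorphyDatum.gl n K hcpt).arch.carrier E}
  {W : ContRepresentation.ClosedSubrep ((AdelicGroupData.gl n K).rightRegular μ)}

variable (hcpt τ W) in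
/-- **`ψ_f`-Whittaker functionals on the multiplicity module**: linear `Λ : M → ℂ` with
`Λ(R((1,u)) ∘ T) = ψ_f(u) Λ(T)` for `u ∈ N_n(𝔸_K^∞)` — the Whittaker functionals of the smooth
`GL_n(𝔸_K^∞)`-module `π_f` (Bump (1997), §3.5; Cogdell (2004), §1.2). [cite: Bump1997, §3.5] -/
def finWhittakerFunctionals : Submodule ℂ (multiplicityModule hcpt τ W →ₗ[ℂ] ℂ) where
  carrier := {Λ | ∀ (u : ↥(upperUnitriangular (Fin n) (FiniteAdeleRing (𝓞 K) K)))
    (T : multiplicityModule hcpt τ W), Λ (finComponentRep hcpt τ W (u : GL (Fin n) (FiniteAdeleRing (𝓞 K) K)) T) = finWhittakerChar n K u * Λ T}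
  add_mem' h₁ h₂ u T := by rw [LinearMap.add_apply, LinearMap.add_apply, h₁ u T, h₂ u T, mul_add]
  zero_mem' u T := by simp
  smul_mem' c Λ h u T := by rw [LinearMap.smul_apply, LinearMap.smul_apply, h u T, smul_eq_mul,
    smul_eq_mul, mul_left_comm]

omit [CompleteSpace E] in
/-- Membership in `finWhittakerFunctionals`. [folklore] -/
theorem mem_finWhittakerFunctionals_iff {Λ : multiplicityModule hcpt τ W →ₗ[ℂ] ℂ} :
    Λ ∈ finWhittakerFunctionals hcpt τ W ↔
      ∀ (u : ↥(upperUnitriangular (Fin n) (FiniteAdeleRing (𝓞 K) K))) (T : multiplicityModule hcpt τ W),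
        Λ (finComponentRep hcpt τ W (u : GL (Fin n) (FiniteAdeleRing (𝓞 K) K)) T) = finWhittakerChar n K u * Λ T :=
  Iff.rfl

end FinWhittaker

/-! ### 2. The transfer map `T ↦ ℓ ∘ T̂` -/

section TransferMap

variable {hcpt : isCompact_glFiniteIntegralLevel n K}
  {E : Type*} [NormedAddCommGroup E] [InnerProductSpace ℂ E] [CompleteSpace E]
  {τ : ContRepresentation ℂ (AutomorphyDatum.gl n K hcpt).arch.carrier E}
  {W : ContRepresentation.ClosedSubrep ((AdelicGroupData.gl n K).rightRegular μ)}

/-- `T̂ v ∈ gardingSpace W` for `T ∈ M` and `v` in the Gårding space of `τ`. [folklore] -/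
theorem corestrictW_mem_gardingSpace_of_mem_multiplicityModule
    {T : E →L[ℂ] (AdelicGroupData.gl n K).L2 μ} (hT : T ∈ multiplicityModule hcpt τ W)
    (hτ : τ.IsStronglyContinuous) {v : E} (hv : v ∈ archGardingSpace hcpt τ) :
    corestrictW (mem_archIntertwiners_of_mem_multiplicityModule hT) v ∈ gardingSpace W := by
  obtain ⟨U₀, hU₀o, hU₀c, hT'⟩ := hT
  exact gardingSubspace_le_gardingSpace U₀ (corestrictW_mem_gardingSubspace hT' hτ hU₀o hU₀c hv)

/-- **The transfer map** `Φ_ℓ : M → (Gårding space of τ)^*`, `Φ_ℓ(T)(v) = ℓ(T̂ v)`: for a linear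
functional `ℓ` on the Gårding space of `W` and `T ∈ M`, the functional `ℓ ∘ T̂` on the Gårding
space of `τ` (`T̂` maps it into `gardingSpace W`). This is `Λ ↦ Λ ∘ (π_∞ ⊗ ξ_f ↪ π)` of the
printed reduction (Cogdell (2004), §1.2). [cite: CogdellAnalyticTheory2004, §1.2] -/
def transferMap (ℓ : gardingSpace W →ₗ[ℂ] ℂ) (hτ : τ.IsStronglyContinuous) :
    multiplicityModule hcpt τ W →ₗ[ℂ] (archGardingSpace hcpt τ →ₗ[ℂ] ℂ) where
  toFun T :=
    { toFun := fun v => ℓ ⟨corestrictW (mem_archIntertwiners_of_mem_multiplicityModule T.2) v,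
        corestrictW_mem_gardingSpace_of_mem_multiplicityModule T.2 hτ v.2⟩
      map_add' := fun v v' => by
        rw [← map_add]
        congr 1
        exact Subtype.ext (map_add (corestrictW _) (v : E) (v' : E))
      map_smul' := fun c v => by
        rw [RingHom.id_apply, ← map_smul]
        congr 1
        exact Subtype.ext (map_smul (corestrictW _) c (v : E)) }
  map_add' S T := by
    refine LinearMap.ext fun v => ?_
    change ℓ _ = ℓ _ + ℓ _
    rw [← map_add]
    exact congrArg ℓ (Subtype.ext (Subtype.ext rfl))
  map_smul' c T := by
    refine LinearMap.ext fun v => ?_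
    change ℓ _ = c • ℓ _
    rw [← map_smul]
    exact congrArg ℓ (Subtype.ext (Subtype.ext rfl))

/-- Unfolding of `transferMap`. [folklore] -/
theorem transferMap_apply_apply (ℓ : gardingSpace W →ₗ[ℂ] ℂ) (hτ : τ.IsStronglyContinuous)
    (T : multiplicityModule hcpt τ W) (v : archGardingSpace hcpt τ) :
    transferMap ℓ hτ T v = ℓ ⟨corestrictW (mem_archIntertwiners_of_mem_multiplicityModule T.2) v,
      corestrictW_mem_gardingSpace_of_mem_multiplicityModule T.2 hτ v.2⟩ :=
  rfl

/-- **On `Hom_{G_∞}(τ, W^{U₀})` the transfer map is `transferFunctional`** (same values; the level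
only enters the membership proofs). [folklore] -/
theorem transferMap_eq_transferFunctional (ℓ : gardingSpace W →ₗ[ℂ] ℂ) (hτ : τ.IsStronglyContinuous)
    {U₀ : Subgroup (GL (Fin n) (FiniteAdeleRing (𝓞 K) K))}
    (hU₀o : IsOpen (U₀ : Set (GL (Fin n) (FiniteAdeleRing (𝓞 K) K))))
    (hU₀c : IsCompact (U₀ : Set (GL (Fin n) (FiniteAdeleRing (𝓞 K) K))))
    {T : E →L[ℂ] (AdelicGroupData.gl n K).L2 μ} (hT : T ∈ archIntertwinersLevel hcpt τ W U₀) :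
    transferMap ℓ hτ ⟨T, mem_multiplicityModule_of_mem_archIntertwinersLevel hU₀o hU₀c hT⟩ =
      transferFunctional ℓ hT hτ hU₀o hU₀c :=
  LinearMap.ext fun _ => rfl

/-- **Values of the transfer map are continuous `ψ_∞`-Whittaker functionals on `τ`** when `ℓ` is a
continuous global `ψ`-Whittaker functional (`isArchContWhittakerFunctional_transferFunctional`).
Cogdell (2004), §1.2. [cite: CogdellAnalyticTheory2004, §1.2] -/
theorem transferMap_mem_archContWhittakerFunctionals {ℓ : gardingSpace W →ₗ[ℂ] ℂ}
    (hℓ : IsContWhittakerFunctional W (adeleAddChar K) ℓ) (hτ : τ.IsStronglyContinuous)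
    (T : multiplicityModule hcpt τ W) :
    transferMap ℓ hτ T ∈ archContWhittakerFunctionals hcpt τ hτ := by
  obtain ⟨U₀, hU₀o, hU₀c, hT⟩ := T.2
  have h := isArchContWhittakerFunctional_transferFunctional hℓ hT hτ hU₀o hU₀c
  rw [← transferMap_eq_transferFunctional ℓ hτ hU₀o hU₀c hT] at h
  exact h

/-- **`ψ_f`-equivariance of the transfer map**: `Φ_ℓ(R((1,u)) ∘ T) = ψ_f(u) Φ_ℓ(T)` for
`u ∈ N_n(𝔸_K^∞)` (`ℓ(R((1,u)) x) = ψ_N((1,u)) ℓ(x)`). [folklore] -/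
theorem transferMap_finComponentRep_unipotent {ℓ : gardingSpace W →ₗ[ℂ] ℂ}
    (hℓ : IsContWhittakerFunctional W (adeleAddChar K) ℓ) (hτ : τ.IsStronglyContinuous)
    (u : ↥(upperUnitriangular (Fin n) (FiniteAdeleRing (𝓞 K) K))) (T : multiplicityModule hcpt τ W) :
    transferMap ℓ hτ (finComponentRep hcpt τ W (u : GL (Fin n) (FiniteAdeleRing (𝓞 K) K)) T) =
      finWhittakerChar n K u • transferMap ℓ hτ T := by
  refine LinearMap.ext fun v => ?_
  rw [LinearMap.smul_apply, transferMap_apply_apply, transferMap_apply_apply, smul_eq_mul]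
  let u' : ↥(adelicUnipotent n K) := ⟨GLn.ofFinite n K u, ofFinite_mem_adelicUnipotent' n K u.2⟩
  let x : gardingSpace W := ⟨corestrictW (mem_archIntertwiners_of_mem_multiplicityModule T.2) v,
    corestrictW_mem_gardingSpace_of_mem_multiplicityModule T.2 hτ v.2⟩
  have h1 : (⟨corestrictW (mem_archIntertwiners_of_mem_multiplicityModule
        (finComponentRep hcpt τ W (u : GL (Fin n) (FiniteAdeleRing (𝓞 K) K)) T).2) v,
      corestrictW_mem_gardingSpace_of_mem_multiplicityModule
        (finComponentRep hcpt τ W (u : GL (Fin n) (FiniteAdeleRing (𝓞 K) K)) T).2 hτ v.2⟩ :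
        gardingSpace W) =
      ⟨W.toContRep (u' : GL (Fin n) (AdeleRing (𝓞 K) K)) x, toContRep_mem_gardingSpace _ x.2⟩ :=
    Subtype.ext (Subtype.ext rfl)
  rw [h1, hℓ.map_unipotent u' x]
  rfl

end TransferMap

/-! ### 3. The reduction: global uniqueness from archimedean and finite-adelic uniqueness -/

section Reduction

variable {hcpt : isCompact_glFiniteIntegralLevel n K}
  {E : Type*} [NormedAddCommGroup E] [InnerProductSpace ℂ E] [CompleteSpace E]
  {τ : ContRepresentation ℂ (AutomorphyDatum.gl n K hcpt).arch.carrier E}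

/-- **The value formula**: for a linear functional `ℓ` on the Gårding space of `Π`, a level-`U₀`
Gårding vector `v = Σ_i S_i (S_i† v)` (`eq_sum_apply_of_mem_gardingSubspace`) has
`ℓ(v) = Σ_i Φ_ℓ(S_i)(S_i† v)`. [folklore] -/
theorem apply_eq_sum_transferMap (P : CuspidalAutomorphicRepGL n K μ)
    (hτu : τ.IsUnitary) (hτi : τ.IsTopIrreducible) (hτ : τ.IsStronglyContinuous)
    (hex : ∃ T ∈ archIntertwiners hcpt τ P.1, T ≠ 0)
    {U₀ : Subgroup (GL (Fin n) (FiniteAdeleRing (𝓞 K) K))}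
    (hU₀o : IsOpen (U₀ : Set (GL (Fin n) (FiniteAdeleRing (𝓞 K) K))))
    (hU₀c : IsCompact (U₀ : Set (GL (Fin n) (FiniteAdeleRing (𝓞 K) K))))
    {k : ℕ} {S : Fin k → E →L[ℂ] (AdelicGroupData.gl n K).L2 μ}
    (hS : ∀ i, S i ∈ archIntertwinersLevel hcpt τ P.1 U₀)
    (hSon : ∀ i j, schurCoeff (μ := μ) (S i) (S j) = if i = j then 1 else 0)
    (hspan : ∀ T ∈ archIntertwinersLevel hcpt τ P.1 U₀, T ∈ Submodule.span ℂ (Set.range S))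
    (ℓ : gardingSpace P.1 →ₗ[ℂ] ℂ) {v : P.1.toSubmodule} (hv : v ∈ gardingSubspace P.1 U₀)
    (hv' : v ∈ gardingSpace P.1) :
    ℓ ⟨v, hv'⟩ = ∑ i, transferMap ℓ hτ
      ⟨S i, mem_multiplicityModule_of_mem_archIntertwinersLevel hU₀o hU₀c (hS i)⟩
      ⟨ContinuousLinearMap.adjoint (S i) (v : (AdelicGroupData.gl n K).L2 μ),
        (eq_sum_apply_of_mem_gardingSubspace P hτu hτi hτ hex hS hSon hspan hU₀o hU₀c hv).1 i⟩ := by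
  obtain ⟨hmem, hsum⟩ := eq_sum_apply_of_mem_gardingSubspace P hτu hτi hτ hex hS hSon hspan hU₀o hU₀c hv
  have hvec : (⟨v, hv'⟩ : gardingSpace P.1) = ∑ i,
      (⟨corestrictW (hS i).1 (ContinuousLinearMap.adjoint (S i) (v : (AdelicGroupData.gl n K).L2 μ)),
        gardingSubspace_le_gardingSpace U₀
          (corestrictW_mem_gardingSubspace (hS i) hτ hU₀o hU₀c (hmem i))⟩ : gardingSpace P.1) := by
    apply Subtype.ext
    apply Subtype.ext
    rw [Submodule.coe_sum, Submodule.coe_sum]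
    exact hsum
  rw [hvec, _root_.map_sum]
  rfl

/-- **A functional whose transfers all vanish is zero**: if `Φ_ℓ(T) = 0` for every `T ∈ M`, then
`ℓ = 0` on the Gårding space of `Π` (every Gårding vector has a level `K_f(𝔫)`,
`IsTestFunctionGL.exists_forall_mul_left_eq`, and the value formula). [folklore] -/
theorem eq_zero_of_transferMap_eq_zero (P : CuspidalAutomorphicRepGL n K μ)
    (hτu : τ.IsUnitary) (hτi : τ.IsTopIrreducible) (hτ : τ.IsStronglyContinuous)
    (hex : ∃ T ∈ archIntertwiners hcpt τ P.1, T ≠ 0)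
    {ℓ : gardingSpace P.1 →ₗ[ℂ] ℂ} (h0 : ∀ T : multiplicityModule hcpt τ P.1, transferMap ℓ hτ T = 0) :
    ℓ = 0 := by
  refine LinearMap.ext fun x => ?_
  obtain ⟨x, hx⟩ := x
  rw [LinearMap.zero_apply]
  induction hx using Submodule.span_induction with
  | mem x hx =>
    obtain ⟨η, f, hη, rfl⟩ := hx
    obtain ⟨𝔫, h𝔫, hk⟩ := hη.exists_forall_mul_left_eq
    have hU₀o := isOpen_finitePrincipalCongruenceLevel n K h𝔫
    have hU₀c := isCompact_finitePrincipalCongruenceLevel n K h𝔫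
    have hv : smoothedVector P.1 η f ∈ gardingSubspace P.1 (finitePrincipalCongruenceLevel n K 𝔫) :=
      smoothedVector_mem_gardingSubspace hη (fun u hu g => hk _ (Subgroup.mem_comap.mp hu) g) f
    obtain ⟨k, S, hS, hSon, hspan, -⟩ := exists_levelPiece_decomposition hcpt P hτu hτi hex hU₀o hU₀c
    rw [apply_eq_sum_transferMap P hτu hτi hτ hex hU₀o hU₀c hS hSon hspan ℓ hv]
    refine Finset.sum_eq_zero fun i _ => ?_
    rw [h0, LinearMap.zero_apply]
  | zero => exact map_zero ℓ
  | add x y hx hy hx' hy' =>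
    have h : (⟨x + y, Submodule.add_mem _ hx hy⟩ : gardingSpace P.1) = ⟨x, hx⟩ + ⟨y, hy⟩ := rfl
    rw [h, map_add, hx', hy', add_zero]
  | smul c x hx hx' =>
    have h : (⟨c • x, Submodule.smul_mem _ c hx⟩ : gardingSpace P.1) = c • ⟨x, hx⟩ := rfl
    rw [h, map_smul, hx', smul_zero]

/-- **In a line every vector is its coordinate times the generator**: if every `φ ∈ A` is a multiple
of `lam₀`, `lam₀ v₀ ≠ 0`, then `φ = (φ v₀ / lam₀ v₀) • lam₀` for `φ ∈ A`. [folklore] -/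
theorem eq_coord_smul_of_forall_exists_smul {V : Type*} [AddCommGroup V] [Module ℂ V]
    {A : Set (V →ₗ[ℂ] ℂ)} {lam₀ : V →ₗ[ℂ] ℂ} (hA : ∀ φ ∈ A, ∃ c : ℂ, φ = c • lam₀) {v₀ : V}
    (hv₀ : lam₀ v₀ ≠ 0) {φ : V →ₗ[ℂ] ℂ} (hφ : φ ∈ A) : φ = ((lam₀ v₀)⁻¹ * φ v₀) • lam₀ := by
  obtain ⟨c, rfl⟩ := hA φ hφ
  congr 1
  rw [LinearMap.smul_apply, smul_eq_mul, mul_left_comm, inv_mul_cancel₀ hv₀, mul_one]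

/-- **`rank ≤ 1` gives proportionality** in a submodule: for `a ≠ 0`, `b` in a submodule of rank at
most one, `b = c • a` (`rank_le_one_iff`). [folklore] -/
theorem exists_eq_smul_of_rank_le_one {V : Type*} [AddCommGroup V] [Module ℂ V] (S : Submodule ℂ V)
    (hrank : Module.rank ℂ S ≤ 1) {a b : V} (ha : a ∈ S) (hb : b ∈ S) (hne : a ≠ 0) :
    ∃ c : ℂ, b = c • a := by
  haveI : Module.Free ℂ S := Module.Free.of_divisionRing ℂ S
  obtain ⟨v₀, hv₀⟩ := rank_le_one_iff.1 hrank
  obtain ⟨x, hx⟩ := hv₀ ⟨a, ha⟩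
  obtain ⟨y, hy⟩ := hv₀ ⟨b, hb⟩
  have hx' : x • (v₀ : V) = a := congrArg Subtype.val hx
  have hy' : y • (v₀ : V) = b := congrArg Subtype.val hy
  have hx0 : x ≠ 0 := by
    rintro rfl
    exact hne (by rw [← hx', zero_smul])
  refine ⟨y * x⁻¹, ?_⟩
  rw [← hy', ← hx', smul_smul, inv_mul_cancel_right₀ hx0]

set_option maxHeartbeats 800000 in
/-- **Uniqueness of global Whittaker functionals from local uniqueness** (the reduction of
Cogdell (2004), §1.2, proof of Cor. 1.4 / Bump (1997), proof of Thm. 3.5.2 / Getz–Hahn (2024), proof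
of Thm. 11.3.4, for continuous functionals on the Gårding space of a cuspidal `Π ≤ L²_cusp`): let
`τ` be the archimedean component of `Π` (irreducible unitary, with a non-zero intertwiner
`τ → Π`). If
(A) the continuous `ψ_∞`-Whittaker functionals on the Gårding space of `τ` are unique up to
    scalars (Shalika's local multiplicity one at the archimedean place, G–H Thm. 11.3.1), and
(F) the `ψ_f`-Whittaker functionals on the multiplicity module `M ≅ π_f` are unique up to scalars
    (local multiplicity one at the finite places, assembled),
then two continuous `ψ`-Whittaker functionals `ℓ₁ ≠ 0`, `ℓ₂` on the Gårding space of `Π` are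
proportional. Proof: `Φ_{ℓ₁}(T₀) = lam₀ ≠ 0` for some `T₀ ∈ M` (else `ℓ₁ = 0`,
`eq_zero_of_transferMap_eq_zero`); by (A) every `Φ_{ℓ_j}(T) = Λ_j(T) lam₀` with `Λ_j = ev ∘ Φ_{ℓ_j}`
a `ψ_f`-Whittaker functional on `M`, `Λ₁(T₀) = 1`; by (F) `Λ₂ = c Λ₁`; and
`ℓ_j(v) = Σ_i Λ_j(S_i) lam₀(S_i† v)` on each `gardingSubspace Π U₀` (`apply_eq_sum_transferMap`), which
exhaust the Gårding space. [cite: CogdellAnalyticTheory2004, §1.2 (proof of Cor. 1.4)] -/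
theorem exists_eq_smul_of_local_uniqueness (P : CuspidalAutomorphicRepGL n K μ)
    (hτu : τ.IsUnitary) (hτi : τ.IsTopIrreducible) (hτ : τ.IsStronglyContinuous)
    (hex : ∃ T ∈ archIntertwiners hcpt τ P.1, T ≠ 0)
    (hA : ∀ φ₁ φ₂ : archGardingSpace hcpt τ →ₗ[ℂ] ℂ, φ₁ ∈ archContWhittakerFunctionals hcpt τ hτ →
      φ₂ ∈ archContWhittakerFunctionals hcpt τ hτ → φ₁ ≠ 0 → ∃ c : ℂ, φ₂ = c • φ₁)
    (hF : ∀ Λ₁ Λ₂ : multiplicityModule hcpt τ P.1 →ₗ[ℂ] ℂ, Λ₁ ∈ finWhittakerFunctionals hcpt τ P.1 →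
      Λ₂ ∈ finWhittakerFunctionals hcpt τ P.1 → Λ₁ ≠ 0 → ∃ c : ℂ, Λ₂ = c • Λ₁)
    {ℓ₁ ℓ₂ : gardingSpace P.1 →ₗ[ℂ] ℂ} (h₁ : IsContWhittakerFunctional P.1 (adeleAddChar K) ℓ₁)
    (h₂ : IsContWhittakerFunctional P.1 (adeleAddChar K) ℓ₂) (hne : ℓ₁ ≠ 0) :
    ∃ c : ℂ, ℓ₂ = c • ℓ₁ := by
  classical
  -- some transfer of `ℓ₁` is non-zero
  have hex₁ : ∃ T₀ : multiplicityModule hcpt τ P.1, transferMap ℓ₁ hτ T₀ ≠ 0 := by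
    by_contra h
    push Not at h
    exact hne (eq_zero_of_transferMap_eq_zero P hτu hτi hτ hex h)
  obtain ⟨T₀, hT₀⟩ := hex₁
  set lam₀ : archGardingSpace hcpt τ →ₗ[ℂ] ℂ := transferMap ℓ₁ hτ T₀ with hlam₀
  have hlam₀A : lam₀ ∈ archContWhittakerFunctionals hcpt τ hτ :=
    transferMap_mem_archContWhittakerFunctionals h₁ hτ T₀
  have hv₀ : ∃ v₀ : archGardingSpace hcpt τ, lam₀ v₀ ≠ 0 := by
    by_contra h
    push Not at h
    exact hT₀ (LinearMap.ext h)
  obtain ⟨v₀, hv₀⟩ := hv₀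
  have hA' : ∀ φ ∈ (archContWhittakerFunctionals hcpt τ hτ : Set (archGardingSpace hcpt τ →ₗ[ℂ] ℂ)),
      ∃ c : ℂ, φ = c • lam₀ := fun φ hφ => hA lam₀ φ hlam₀A hφ hT₀
  -- the coordinate functional `ev φ = φ v₀ / lam₀ v₀` on the line `A = ℂ lam₀`
  obtain ⟨ev, hev_apply⟩ : ∃ ev : (archGardingSpace hcpt τ →ₗ[ℂ] ℂ) →ₗ[ℂ] ℂ,
      ∀ φ : archGardingSpace hcpt τ →ₗ[ℂ] ℂ, ev φ = (lam₀ v₀)⁻¹ * φ v₀ :=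
    ⟨(lam₀ v₀)⁻¹ • LinearMap.applyₗ v₀, fun φ => rfl⟩
  have hev : ∀ φ ∈ archContWhittakerFunctionals hcpt τ hτ, φ = ev φ • lam₀ := fun φ hφ => by
    rw [hev_apply]
    exact eq_coord_smul_of_forall_exists_smul hA' hv₀ hφ
  -- the `ψ_f`-Whittaker functionals `Λ_j = ev ∘ Φ_{ℓ_j}` on `M`
  have hW : ∀ {ℓ : gardingSpace P.1 →ₗ[ℂ] ℂ}, IsContWhittakerFunctional P.1 (adeleAddChar K) ℓ →
      ev ∘ₗ transferMap ℓ hτ ∈ finWhittakerFunctionals hcpt τ P.1 := fun hℓ u T => by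
    rw [LinearMap.comp_apply, LinearMap.comp_apply, transferMap_finComponentRep_unipotent hℓ hτ u T, map_smul,
      smul_eq_mul]
  have hΛ₁ne : ev ∘ₗ transferMap ℓ₁ hτ ≠ 0 := by
    intro h
    have h1 : (ev ∘ₗ transferMap ℓ₁ hτ) T₀ = 1 := by
      rw [LinearMap.comp_apply, hev_apply]
      exact inv_mul_cancel₀ hv₀
    rw [h, LinearMap.zero_apply] at h1
    exact zero_ne_one h1
  obtain ⟨c, hc⟩ := hF _ _ (hW h₁) (hW h₂) hΛ₁ne
  refine ⟨c, LinearMap.ext fun x => ?_⟩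
  obtain ⟨x, hx⟩ := x
  rw [LinearMap.smul_apply, smul_eq_mul]
  induction hx using Submodule.span_induction with
  | mem x hx =>
    obtain ⟨η, f, hη, rfl⟩ := hx
    obtain ⟨𝔫, h𝔫, hk⟩ := hη.exists_forall_mul_left_eq
    have hU₀o := isOpen_finitePrincipalCongruenceLevel n K h𝔫
    have hU₀c := isCompact_finitePrincipalCongruenceLevel n K h𝔫
    have hv : smoothedVector P.1 η f ∈ gardingSubspace P.1 (finitePrincipalCongruenceLevel n K 𝔫) :=
      smoothedVector_mem_gardingSubspace hη (fun u hu g => hk _ (Subgroup.mem_comap.mp hu) g) f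
    obtain ⟨k, S, hS, hSon, hspan, -⟩ := exists_levelPiece_decomposition hcpt P hτu hτi hex hU₀o hU₀c
    rw [apply_eq_sum_transferMap P hτu hτi hτ hex hU₀o hU₀c hS hSon hspan ℓ₂ hv,
      apply_eq_sum_transferMap P hτu hτi hτ hex hU₀o hU₀c hS hSon hspan ℓ₁ hv, Finset.mul_sum]
    refine Finset.sum_congr rfl fun i _ => ?_
    set Ti : multiplicityModule hcpt τ P.1 :=
      ⟨S i, mem_multiplicityModule_of_mem_archIntertwinersLevel hU₀o hU₀c (hS i)⟩ with hTi
    have e₂ := hev _ (transferMap_mem_archContWhittakerFunctionals h₂ hτ Ti)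
    have e₁ := hev _ (transferMap_mem_archContWhittakerFunctionals h₁ hτ Ti)
    have hc' : ev (transferMap ℓ₂ hτ Ti) = c * ev (transferMap ℓ₁ hτ Ti) := by
      have h := LinearMap.congr_fun hc Ti
      rw [LinearMap.smul_apply, smul_eq_mul, LinearMap.comp_apply, LinearMap.comp_apply] at h
      exact h
    set u : archGardingSpace hcpt τ :=
      ⟨ContinuousLinearMap.adjoint (S i) ((smoothedVector P.1 η f : P.1.toSubmodule) : (AdelicGroupData.gl n K).L2 μ),
        (eq_sum_apply_of_mem_gardingSubspace P hτu hτi hτ hex hS hSon hspan hU₀o hU₀c hv).1 i⟩ with hu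
    have g₂ : transferMap ℓ₂ hτ Ti u = ev (transferMap ℓ₂ hτ Ti) * lam₀ u := by
      conv_lhs => rw [e₂]
      rfl
    have g₁ : transferMap ℓ₁ hτ Ti u = ev (transferMap ℓ₁ hτ Ti) * lam₀ u := by
      conv_lhs => rw [e₁]
      rfl
    rw [g₂, g₁, hc', mul_assoc]
  | zero =>
    have h : (⟨0, Submodule.zero_mem _⟩ : gardingSpace P.1) = 0 := rfl
    rw [h, map_zero, map_zero, mul_zero]
  | add x y hx hy hx' hy' =>
    have h : (⟨x + y, Submodule.add_mem _ hx hy⟩ : gardingSpace P.1) = ⟨x, hx⟩ + ⟨y, hy⟩ := rfl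
    rw [h, map_add, map_add, hx', hy', mul_add]
  | smul a x hx hx' =>
    have h : (⟨a • x, Submodule.smul_mem _ a hx⟩ : gardingSpace P.1) = a • ⟨x, hx⟩ := rfl
    rw [h, map_smul, map_smul, hx', smul_eq_mul, smul_eq_mul, mul_left_comm]

/-- **The same with `rank ≤ 1` hypotheses**: if `dim_ℂ` (continuous `ψ_∞`-Whittaker functionals on
`τ`) `≤ 1` and `dim_ℂ` (`ψ_f`-Whittaker functionals on `M`) `≤ 1`, then
`dim_ℂ` (continuous `ψ`-Whittaker functionals on `Π`) `≤ 1` in the proportionality form used by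
`multiplicity_one_gl_of_isContWhittakerFunctional_unique`. [cite: CogdellAnalyticTheory2004, §1.2 (proof of Cor. 1.4)] -/
theorem exists_eq_smul_of_rank_le_one_of_rank_le_one (P : CuspidalAutomorphicRepGL n K μ)
    (hτu : τ.IsUnitary) (hτi : τ.IsTopIrreducible) (hτ : τ.IsStronglyContinuous)
    (hex : ∃ T ∈ archIntertwiners hcpt τ P.1, T ≠ 0)
    (hA : Module.rank ℂ (archContWhittakerFunctionals hcpt τ hτ) ≤ 1)
    (hF : Module.rank ℂ (finWhittakerFunctionals hcpt τ P.1) ≤ 1)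
    {ℓ₁ ℓ₂ : gardingSpace P.1 →ₗ[ℂ] ℂ} (h₁ : IsContWhittakerFunctional P.1 (adeleAddChar K) ℓ₁)
    (h₂ : IsContWhittakerFunctional P.1 (adeleAddChar K) ℓ₂) (hne : ℓ₁ ≠ 0) :
    ∃ c : ℂ, ℓ₂ = c • ℓ₁ :=
  exists_eq_smul_of_local_uniqueness P hτu hτi hτ hex
    (fun _ _ ha hb hne' => exists_eq_smul_of_rank_le_one _ hA ha hb hne')
    (fun _ _ ha hb hne' => exists_eq_smul_of_rank_le_one _ hF ha hb hne') h₁ h₂ hne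

end Reduction

end Literature.NumberTheory.Automorphic
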